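import Mathlib
import Summits.AtomisticToContinuum.FouriersLaw.Theorems.EmbeddedDrudeMourreDrudeDissolutionCutoffSupFamily
import Summits.AtomisticToContinuum.FouriersLaw.Theorems.EmbeddedDrudeMourreDrudeDissolutionStubExcursionSecondDifferenceCubeAssembly
import HarnessLib

/-!
# Stub B1b″ `stub_excursionSecondDifference` of line `kinetic-polymer-gas-on-the-time-axis` — CLOSED
(crux `EmbeddedDrudeMourre.DrudeDissolution`, item stmt-AtomisticToContinuum-12593; `--supports` file landing the
registered skeleton stub `stub_excursionSecondDifference` (verbatim signature, skeleton stub namespace); closes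
nothing by itself — the lead wires it into the skeleton; lead c13 (twin processes A+B), 2026-08-17)

WHAT. The dual second-difference (`B^{1+α}_{1,∞}`, `α = 1/3`) regularity of the bracket-weighted two-phonon density of
states `m_f = Ω_*(W_f dk)` of the pinned FPU pair resonance, for every sine polynomial profile `f`:
`|∫ (2φ(x) − φ(x+δ) − φ(x−δ)) dm_f(x)| ≤ C δ^{4/3}` for all `C²` test functions `|φ| ≤ 1` and `δ > 0`.

HOW. The whole sup-norm route of this seat: `stub_excursionSecondDifference_of_supBound` (twin A's (C8)
plumbing: `stub_excursionSecondDifference_of_cube` + `cube_secondDiff_of_cutoffFamily` + regularity/periodicity +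
`cutoff_arguments_zero` + `discard_integral_le` with the tube and corner-ball volumes) applied to
`cutoff_sup_family` (twin B's (C5)+(C6): the cutoff family `Θ_η = ∏ₖ ζ(ρₖ/η²)` and the per-point `η⁻²` sup bound of
the double gradient flux, resting on the Morse–Bott gradient floor `resonance_gradient_floor`, the corner floor,
the Hessian structure and weight structure bounds, and the two regime algebras).
-/

noncomputable section

namespace Summit.AtomisticToContinuum.FouriersLaw.Theorems.DrudeDissolution.KineticPolymerGasOnTheTimeAxis

open MeasureTheory
open Literature.MathematicalPhysics.KineticTheory
open Literature.MathematicalPhysics.KineticTheory.PhononBoltzmann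

/-- **Stub B1b″ `stub_excursionSecondDifference` (registered skeleton stub of crux stmt-AtomisticToContinuum-12593,
line `kinetic-polymer-gas-on-the-time-axis`): dual second-difference regularity of the bracket-weighted density of
states of the pair resonance.** [folklore] -/
theorem stub_excursionSecondDifference :
    ∀ ω₂ a b : ℝ, 0 < ω₂ → ∀ f : ℝ → ℝ,
      (∃ (M : ℕ) (c : Fin M → ℝ), f = fun k => ∑ i, c i * Real.sin (((i : ℕ) + 1 : ℕ) * k)) →
      ∃ C α : ℝ, 0 < α ∧ ∀ δ : ℝ, 0 < δ → ∀ φ : ℝ → ℝ, ContDiff ℝ 2 φ → (∀ x, |φ x| ≤ 1) →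
        |∫ x, (2 * φ x - φ (x + δ) - φ (x - δ))
            ∂(MeasureTheory.Measure.map (fun p : ℝ × ℝ × ℝ => resonanceFn ω₂ p.1 p.2.2 p.2.1)
              (((volume.restrict (Set.Ioc (-Real.pi) Real.pi)).prod
                  ((volume.restrict (Set.Ioc (-Real.pi) Real.pi)).prod
                    (volume.restrict (Set.Ioc (-Real.pi) Real.pi)))).withDensity
                (fun p : ℝ × ℝ × ℝ => ENNReal.ofReal
                  (vertex a b p.1 p.2.2 p.2.1 ^ 2 /
                      (dispersion ω₂ p.1 * dispersion ω₂ p.2.2 * dispersion ω₂ p.2.1 *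
                        dispersion ω₂ (p.1 + p.2.2 - p.2.1)) ^ 2 *
                    (f p.1 + f p.2.2 - f p.2.1 - f (p.1 + p.2.2 - p.2.1)) ^ 2))))| ≤
          C * δ ^ (1 + α) :=
  stub_excursionSecondDifference_of_supBound cutoff_sup_family

end Summit.AtomisticToContinuum.FouriersLaw.Theorems.DrudeDissolution.KineticPolymerGasOnTheTimeAxis

end
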